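import Literature.AlgebraicGeometry.Resolution.CharPolyhedronSolvableVertex
import HarnessLib

/-!
# `δ_𝟙 > 0` and `δ_𝟙 ≥ 1` for a minimal polyhedron (Cossart–Piltant 2019, Prop. 2.3 (i), (ii))

Topic: `Literature/AlgebraicGeometry/Resolution`. PROOF-side companion of
`CharPolyhedronSolvableVertex.lean` (Def. 2.4 `IsMinimal`, and the proof step
`IsMinimal.mem_span_of_map_eq_X_sub_C_pow`) and `ArithmeticalThreefoldsLocalPolyhedron.lean`
(`DeltaGE`, `I_𝟙(a) = 𝔪^⌈a⌉`), in support of the named fact `CossartPiltant2019Local`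
(`ArithmeticalThreefoldsLocal.lean`). Source:

* V. Cossart, O. Piltant, *Resolution of singularities of arithmetical threefolds*, J. Algebra
  529 (2019) 268–535 = arXiv:1412.0868 (v1), Prop. 2.3 (i) (v1 pp. 11–12): if
  `Δ(h; u₁, …, u_n; Z)` is minimal then
  `δ_𝟙(h; u; Z) > 0 ⟺ (η⁻¹(m_S) = {x} and k(x) = S/m_S)`.

The fibre `η⁻¹(m_S) = Spec (S/m_S)[Z]/(h̄)` is a single point with residue field `S/m_S` iff the
reduction `h̄` of the monic polynomial `h` is a power of a linear polynomial, `h̄ = (Z - λ̄)^m`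
(this identification is `Polynomial.eq_sup_span_X_sub_C_of_map_eq_X_sub_C_pow` and the bricks of
`ArithmeticalThreefoldsLocalProofs.lean`); with this reading we PROVE, for `u` generating `m_S`
and satisfying (H):

* `deltaGE_one_pos_iff_forall_mem` — `δ_𝟙(h; u; Z) > 0` (i.e. `δ_𝟙 ≥ q` for some `q > 0`) iff all
  `f_{i,Z} ∈ m_S`, iff `h̄ = Z^m` (`map_eq_X_pow_iff_forall_mem`);
* `IsMinimal.exists_pos_deltaGE_iff` — **Prop. 2.3 (i)**: for `Δ(h; u; Z)` minimal,
  `δ_𝟙 > 0 ⟺ ∃ λ̄, h̄ = (Z - λ̄)^m`; and then necessarily `λ̄ = 0`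
  (`IsMinimal.mem_span_of_map_eq_X_sub_C_pow`);
* `IsMinimal.deltaGE_one_one_iff_exists_mem_pow` — **Prop. 2.3 (ii)**: for `Δ(h; u; Z)` minimal,
  `δ_𝟙 ≥ 1 ⟺ η⁻¹(m_S) ∩ Sing_m 𝒳 ≠ ∅`, with "`ord_x h = m` at `x = (m_S, Z - a)`" rendered as
  `h ∈ (m_S, Z - a)^m ⊆ S[Z]` (`Polynomial.mem_sup_span_X_sub_C_pow_natDegree_iff` of
  `ArithmeticalThreefoldsLocalProofs.lean`).

Everything is PROVED; no definitions and no named facts are introduced.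
-/

open Finset Polynomial IsLocalRing

namespace Literature.AlgebraicGeometry.Resolution.CossartPiltant

universe u

variable {S : Type u} [CommRing S] {N : ℕ}

/-- **`δ_𝟙(h; u; Z) > 0 ⟺ f_{i,Z} ∈ m_S` for `1 ≤ i ≤ m`** (`(u) = 𝔪`): `I_𝟙(a) = 𝔪^⌈a⌉ ⊆ 𝔪`
for `a > 0`, and conversely `𝔪 = I_𝟙(1) ⊆ I_𝟙(i/m)`. [cite: CossartPiltant2019, Prop. 2.3 (i) (arXiv v1 p. 11)] -/
theorem deltaGE_one_pos_iff_forall_mem {u : Fin N → S} {𝔪 : Ideal S}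
    (hu : Ideal.span (Set.range u) = 𝔪) (h : S[X]) :
    (∃ q : ℝ, 0 < q ∧ DeltaGE u (fun _ => (1 : ℝ)) h q) ↔
      ∀ i ∈ Finset.Icc 1 h.natDegree, h.coeff (h.natDegree - i) ∈ 𝔪 := by
  constructor
  · rintro ⟨q, hq, hD⟩ i hi
    have hmem := hD i hi
    rw [monomialIdeal_one_eq_pow hu] at hmem
    have hipos : (0 : ℝ) < i := by exact_mod_cast (Finset.mem_Icc.mp hi).1
    have hceil : 1 ≤ ⌈(i : ℝ) * q⌉₊ := Nat.one_le_iff_ne_zero.mpr (by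
      rw [Ne, Nat.ceil_eq_zero, not_le]
      exact mul_pos hipos hq)
    exact Ideal.pow_le_self (by omega) hmem
  · intro hall
    by_cases hm : h.natDegree = 0
    · refine ⟨1, one_pos, fun i hi => ?_⟩
      exfalso
      rw [hm] at hi
      have := Finset.mem_Icc.mp hi
      omega
    have hmpos : (0 : ℝ) < h.natDegree := by exact_mod_cast Nat.pos_of_ne_zero hm
    refine ⟨1 / h.natDegree, by positivity, fun i hi => ?_⟩
    rw [monomialIdeal_one_eq_pow hu]
    have hile : (i : ℝ) * (1 / h.natDegree) ≤ 1 := by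
      rw [mul_one_div, div_le_one hmpos]
      exact_mod_cast (Finset.mem_Icc.mp hi).2
    have hceil : ⌈(i : ℝ) * (1 / h.natDegree)⌉₊ ≤ 1 := by
      refine Nat.ceil_le.mpr ?_
      simpa using hile
    rcases Nat.le_one_iff_eq_zero_or_eq_one.mp hceil with h0 | h1
    · rw [h0, pow_zero, Ideal.one_eq_top]
      trivial
    · rw [h1, pow_one]
      exact hall i hi

/-- `h̄ = X^m` in `(S/𝔪)[X]` iff all `f_{i,X} ∈ 𝔪` (`h` monic). [folklore] -/
theorem map_eq_X_pow_iff_forall_mem {𝔪 : Ideal S} {h : S[X]} (hh : h.Monic) :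
    h.map (Ideal.Quotient.mk 𝔪) = X ^ h.natDegree ↔
      ∀ i ∈ Finset.Icc 1 h.natDegree, h.coeff (h.natDegree - i) ∈ 𝔪 := by
  constructor
  · intro hmap i hi
    obtain ⟨hi1, him⟩ := Finset.mem_Icc.mp hi
    have := congrArg (fun q => q.coeff (h.natDegree - i)) hmap
    simp only [Polynomial.coeff_map, Polynomial.coeff_X_pow] at this
    rw [if_neg (by omega)] at this
    exact Ideal.Quotient.eq_zero_iff_mem.mp this
  · intro hall
    refine Polynomial.ext fun k => ?_
    rw [Polynomial.coeff_map, Polynomial.coeff_X_pow]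
    split_ifs with hk
    · rw [hk, hh.coeff_natDegree, map_one]
    · rcases lt_or_gt_of_ne hk with hlt | hgt
      · have hmem := hall (h.natDegree - k) (Finset.mem_Icc.mpr ⟨by omega, by omega⟩)
        rw [Nat.sub_sub_self hlt.le] at hmem
        exact Ideal.Quotient.eq_zero_iff_mem.mpr hmem
      · rw [Polynomial.coeff_eq_zero_of_natDegree_lt hgt, map_zero]

/-- **Prop. 2.3 (i)**: for a minimal polyhedron `Δ_S(h; u; Z)` (Def. 2.4), `(u) = m_S`, `h` monic
of degree `m ≥ 1`: `δ_𝟙(h; u; Z) > 0` iff the reduction `h̄ ∈ (S/m_S)[Z]` is the `m`-th power of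
a linear polynomial — i.e. iff `η⁻¹(m_S) = {x}` with `k(x) = S/m_S` — and in that case the root
is `0`, `h̄ = Z^m`. [cite: CossartPiltant2019, Prop. 2.3 (i) (arXiv v1 pp. 11–12)] -/
theorem IsMinimal.exists_pos_deltaGE_iff [IsNoetherianRing S] [IsLocalRing S] {u : Fin N → S}
    (H : ∀ (i : Fin N) (T : Finset (Fin N)), i ∉ T →
      ∀ y, u i * y ∈ Ideal.span (u '' ↑T) → y ∈ Ideal.span (u '' ↑T))
    (hu : Ideal.span (Set.range u) = maximalIdeal S) {h : S[X]} (hh : h.Monic)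
    (hm : 1 ≤ h.natDegree) (hmin : IsMinimal u h) :
    (∃ q : ℝ, 0 < q ∧ DeltaGE u (fun _ => (1 : ℝ)) h q) ↔
      ∃ lam : S, h.map (Ideal.Quotient.mk (maximalIdeal S)) =
        (X - C (Ideal.Quotient.mk (maximalIdeal S) lam)) ^ h.natDegree := by
  have hu' : ∀ i, u i ∈ maximalIdeal S := fun i => hu ▸ Ideal.subset_span (Set.mem_range_self i)
  rw [deltaGE_one_pos_iff_forall_mem hu h, ← map_eq_X_pow_iff_forall_mem hh]
  constructor
  · intro hX
    exact ⟨0, by rw [hX, map_zero, C_0, sub_zero]⟩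
  · rintro ⟨lam, hlam⟩
    have hP : (Ideal.span (Set.range u)).IsPrime := hu ▸ (maximalIdeal.isMaximal S).isPrime
    have hlam' : h.map (Ideal.Quotient.mk (Ideal.span (Set.range u))) =
        (X - C (Ideal.Quotient.mk (Ideal.span (Set.range u)) lam)) ^ h.natDegree := by
      have h1 := hlam
      rw [← hu] at h1
      exact h1
    have hmem := hmin.mem_span_of_map_eq_X_sub_C_pow H hu' hP hm hlam'
    rw [hu] at hmem
    rw [hlam, (Ideal.Quotient.eq_zero_iff_mem.mpr hmem), C_0, sub_zero]

/-- **Prop. 2.3 (i), the root**: for a minimal polyhedron, `h̄ = (Z - λ̄)^m` forces `λ̄ = 0`.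
[cite: CossartPiltant2019, Prop. 2.3 (i) (arXiv v1 p. 12)] -/
theorem IsMinimal.map_eq_X_pow_of_map_eq_X_sub_C_pow [IsNoetherianRing S] [IsLocalRing S]
    {u : Fin N → S}
    (H : ∀ (i : Fin N) (T : Finset (Fin N)), i ∉ T →
      ∀ y, u i * y ∈ Ideal.span (u '' ↑T) → y ∈ Ideal.span (u '' ↑T))
    (hu : Ideal.span (Set.range u) = maximalIdeal S) {h : S[X]}
    (hm : 1 ≤ h.natDegree) (hmin : IsMinimal u h) {lam : S}
    (hlam : h.map (Ideal.Quotient.mk (maximalIdeal S)) =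
      (X - C (Ideal.Quotient.mk (maximalIdeal S) lam)) ^ h.natDegree) :
    h.map (Ideal.Quotient.mk (maximalIdeal S)) = X ^ h.natDegree := by
  have hu' : ∀ i, u i ∈ maximalIdeal S := fun i => hu ▸ Ideal.subset_span (Set.mem_range_self i)
  have hP : (Ideal.span (Set.range u)).IsPrime := hu ▸ (maximalIdeal.isMaximal S).isPrime
  have hlam' : h.map (Ideal.Quotient.mk (Ideal.span (Set.range u))) =
      (X - C (Ideal.Quotient.mk (Ideal.span (Set.range u)) lam)) ^ h.natDegree := by
    have h1 := hlam
    rw [← hu] at h1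
    exact h1
  have hmem := hmin.mem_span_of_map_eq_X_sub_C_pow H hu' hP hm hlam'
  rw [hu] at hmem
  rw [hlam, (Ideal.Quotient.eq_zero_iff_mem.mpr hmem), C_0, sub_zero]

/-! ## Prop. 2.3 (ii): `δ_𝟙 ≥ 1 ⟺ η⁻¹(m_S) ∩ Sing_m 𝒳 ≠ ∅` for a minimal polyhedron -/

/-- Reduction modulo `𝔪` of the ideal `(𝔪, X - a)^m ⊆ S[X]`: a member `h` has `(X - ā)^m ∣ h̄`
in `(S/𝔪)[X]`. [folklore] -/
theorem X_sub_C_pow_dvd_map_of_mem_pow {𝔪 : Ideal S} {a : S} {m : ℕ} {h : S[X]}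
    (hmem : h ∈ (𝔪.map (C : S →+* S[X]) ⊔ Ideal.span {X - C a}) ^ m) :
    (X - C (Ideal.Quotient.mk 𝔪 a)) ^ m ∣ h.map (Ideal.Quotient.mk 𝔪) := by
  set φ := Polynomial.mapRingHom (Ideal.Quotient.mk 𝔪) with hφ
  have hmap : ((𝔪.map (C : S →+* S[X]) ⊔ Ideal.span {X - C a}) ^ m).map φ =
      Ideal.span {(X - C (Ideal.Quotient.mk 𝔪 a)) ^ m} := by
    rw [Ideal.map_pow, Ideal.map_sup, Ideal.map_map, Ideal.map_span, Set.image_singleton]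
    have h0 : 𝔪.map (φ.comp C) = ⊥ := by
      refine (Ideal.map_eq_bot_iff_le_ker _).mpr fun s hs => ?_
      rw [RingHom.mem_ker, RingHom.comp_apply, hφ, Polynomial.coe_mapRingHom, Polynomial.map_C,
        Ideal.Quotient.eq_zero_iff_mem.mpr hs, C_0]
    rw [h0, bot_sup_eq, Ideal.span_singleton_pow]
    congr 2
    rw [hφ, Polynomial.coe_mapRingHom, Polynomial.map_sub, Polynomial.map_X, Polynomial.map_C]
  have := Ideal.mem_map_of_mem φ hmem
  rw [hmap, Ideal.mem_span_singleton] at this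
  exact this

/-- `ord_x h = m` at `x = (𝔪, X - a)` forces `h̄ = (X - ā)^m` for `h` monic of degree `m`.
[cite: CossartPiltant2019, Prop. 2.3, proof (arXiv v1 pp. 11–12)] -/
theorem map_eq_X_sub_C_pow_of_mem_pow {𝔪 : Ideal S} [Nontrivial (S ⧸ 𝔪)] {a : S} {h : S[X]}
    (hh : h.Monic)
    (hmem : h ∈ (𝔪.map (C : S →+* S[X]) ⊔ Ideal.span {X - C a}) ^ h.natDegree) :
    h.map (Ideal.Quotient.mk 𝔪) = (X - C (Ideal.Quotient.mk 𝔪 a)) ^ h.natDegree := by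
  have hdvd := X_sub_C_pow_dvd_map_of_mem_pow hmem
  refine Polynomial.eq_of_monic_of_dvd_of_natDegree_le ((monic_X_sub_C _).pow _) (hh.map _) hdvd ?_
  rw [hh.natDegree_map, (monic_X_sub_C _).natDegree_pow, natDegree_X_sub_C, mul_one]

/-- For `a ∈ 𝔪`, the ideals `(𝔪, X - a)` and `(𝔪, X)` of `S[X]` coincide. [folklore] -/
theorem sup_span_X_sub_C_eq_of_mem {𝔪 : Ideal S} {a : S} (ha : a ∈ 𝔪) :
    𝔪.map (C : S →+* S[X]) ⊔ Ideal.span {X - C a} =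
      𝔪.map (C : S →+* S[X]) ⊔ Ideal.span {X - C (0 : S)} := by
  have hCa : C a ∈ 𝔪.map (C : S →+* S[X]) := Ideal.mem_map_of_mem _ ha
  apply le_antisymm
  · refine sup_le le_sup_left ((Ideal.span_singleton_le_iff_mem _).mpr ?_)
    have : X - C a = (X - C (0 : S)) - C a := by rw [C_0, sub_zero]
    rw [this]
    exact sub_mem (Ideal.mem_sup_right (Ideal.mem_span_singleton_self _)) (Ideal.mem_sup_left hCa)
  · refine sup_le le_sup_left ((Ideal.span_singleton_le_iff_mem _).mpr ?_)
    have : X - C (0 : S) = (X - C a) + C a := by rw [C_0, sub_zero, sub_add_cancel]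
    rw [this]
    exact add_mem (Ideal.mem_sup_right (Ideal.mem_span_singleton_self _)) (Ideal.mem_sup_left hCa)

/-- **Prop. 2.3 (ii)**: for a minimal polyhedron `Δ_S(h; u; Z)` (`(u) = m_S`, `h` monic of degree
`m ≥ 1`): `δ_𝟙(h; u; Z) ≥ 1` iff `η⁻¹(m_S) ∩ Sing_m 𝒳 ≠ ∅`, i.e. iff `ord_x h = m` at some point
`x = (m_S, Z - a)` of the fibre, rendered as `h ∈ (m_S, Z - a)^m ⊆ S[Z]`.  ("only if": `a = 0`;
"if": `x ∈ Sing_m` gives `h̄ = (Z - ā)^m`, minimality gives `ā = 0`, so `x = (m_S, Z)` and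
`ord_x h = m` means `f_{i,Z} ∈ m_S^i`.) [cite: CossartPiltant2019, Prop. 2.3 (ii) (arXiv v1 pp. 11–12)] -/
theorem IsMinimal.deltaGE_one_one_iff_exists_mem_pow [IsNoetherianRing S] [IsLocalRing S]
    {u : Fin N → S}
    (H : ∀ (i : Fin N) (T : Finset (Fin N)), i ∉ T →
      ∀ y, u i * y ∈ Ideal.span (u '' ↑T) → y ∈ Ideal.span (u '' ↑T))
    (hu : Ideal.span (Set.range u) = maximalIdeal S) {h : S[X]} (hh : h.Monic)
    (hm : 1 ≤ h.natDegree) (hmin : IsMinimal u h) :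
    DeltaGE u (fun _ => (1 : ℝ)) h 1 ↔
      ∃ a : S, h ∈ ((maximalIdeal S).map (C : S →+* S[X]) ⊔ Ideal.span {X - C a}) ^ h.natDegree := by
  rw [deltaGE_one_one_iff hu]
  constructor
  · intro hcoef
    refine ⟨0, Polynomial.mem_sup_span_X_sub_C_pow_natDegree_iff.mpr fun i hi1 hi2 => ?_⟩
    rw [taylor_zero]
    exact hcoef i hi1 hi2
  · rintro ⟨a, ha⟩
    -- `x = (m_S, Z - a) ∈ Sing_m`: `h̄ = (Z - ā)^m`, so `ā = 0` by minimality
    have hmap := map_eq_X_sub_C_pow_of_mem_pow hh ha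
    have hX := hmin.map_eq_X_pow_of_map_eq_X_sub_C_pow H hu hm hmap
    -- hence `a ∈ m_S`: compare constant coefficients, `(-ā)^m = 0` in the residue field
    have ha𝔪 : a ∈ maximalIdeal S := by
      have h1 := congrArg (fun q => q.coeff 0) (hmap.symm.trans hX)
      simp only [coeff_X_pow, if_neg (show (0 : ℕ) ≠ h.natDegree by omega)] at h1
      rw [sub_eq_add_neg, ← C_neg, coeff_X_add_C_pow, Nat.sub_zero, Nat.choose_zero_right,
        Nat.cast_one, mul_one] at h1
      have h2 : Ideal.Quotient.mk (maximalIdeal S) a = 0 :=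
        neg_eq_zero.mp (pow_eq_zero_iff (by omega) |>.mp h1)
      exact Ideal.Quotient.eq_zero_iff_mem.mp h2
    rw [sup_span_X_sub_C_eq_of_mem ha𝔪, Polynomial.mem_sup_span_X_sub_C_pow_natDegree_iff] at ha
    intro i hi1 hi2
    have := ha i hi1 hi2
    rwa [taylor_zero] at this

end Literature.AlgebraicGeometry.Resolution.CossartPiltant

namespace Literature.AlgebraicGeometry.Resolution.IsRsopPart

open CossartPiltant

universe u

variable {R : Type u} [CommRing R] [IsLocalRing R] {n : ℕ} {z : Fin n → R}

/-- **Prop. 2.3 (i)** for a full regular system of parameters `z` of a regular local ring.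
[cite: CossartPiltant2019, Prop. 2.3 (i) (arXiv v1 pp. 11–12)] -/
theorem exists_pos_deltaGE_iff_of_isMinimal (hz : IsRsopPart z)
    (hzm : Ideal.span (Set.range z) = maximalIdeal R) {h : R[X]} (hh : h.Monic)
    (hm : 1 ≤ h.natDegree) (hmin : IsMinimal z h) :
    (∃ q : ℝ, 0 < q ∧ DeltaGE z (fun _ => (1 : ℝ)) h q) ↔
      ∃ lam : R, h.map (Ideal.Quotient.mk (maximalIdeal R)) =
        (X - C (Ideal.Quotient.mk (maximalIdeal R) lam)) ^ h.natDegree := by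
  haveI := hz.isRegularLocalRing
  exact hmin.exists_pos_deltaGE_iff hz.mem_span_image_of_mul_mem hzm hh hm

/-- **Prop. 2.3 (ii)** for a full regular system of parameters of a regular local ring.
[cite: CossartPiltant2019, Prop. 2.3 (ii) (arXiv v1 pp. 11–12)] -/
theorem deltaGE_one_one_iff_exists_mem_pow_of_isMinimal (hz : IsRsopPart z)
    (hzm : Ideal.span (Set.range z) = maximalIdeal R) {h : R[X]} (hh : h.Monic)
    (hm : 1 ≤ h.natDegree) (hmin : IsMinimal z h) :
    DeltaGE z (fun _ => (1 : ℝ)) h 1 ↔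
      ∃ a : R, h ∈ ((maximalIdeal R).map (C : R →+* R[X]) ⊔ Ideal.span {X - C a}) ^ h.natDegree := by
  haveI := hz.isRegularLocalRing
  exact hmin.deltaGE_one_one_iff_exists_mem_pow hz.mem_span_image_of_mul_mem hzm hh hm

end Literature.AlgebraicGeometry.Resolution.IsRsopPart
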